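import Summits.ValiantsHypothesis.ValiantsHypothesis.Theorems.NcSawtoothMask
import HarnessLib

/-!
# ★ The tilted-sawtooth interval lemma `saw_designated` — H3c of O-L6-20 (T2)

THEOREM (★ `saw_designated`). For `g ≥ 1`, `4k + 2 ≤ t`, every parse-tree SHAPE with `D = 6tg` leaves
and non-skew depth `nsd ≤ k`, placed on `[0, D)`, has (in preorder) a node whose interval is GOOD for
the tilted sawtooth mask: `des (ivGood (sawMask t g) (D/2 − g)) S 0 ≠ none` — i.e. `(3tg − g)`-close
to `A` or to `Aᶜ` in FLOS20's distance. With the Hankel interval instrument (`hankel_interval_bound`,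
H2b) and the pairing permanent (`NcPairingPermanent`) this is the non-skew-depth rung.
PROOF (written case-complete in the lane's PROOF-saw.md; here its Lean transcription). Heights
`h = sawH` (H3b). A pair `(x, y)` is LEGAL if `|h(y) − h(x)| ≤ g − 1`; by the goodness bridge
(`saw_good` ← `ivGood_of_le` + `card_sawMask` + `hgt_sawMask`) a node whose interval is not good sits
on a legal pair. INVARIANT `Inv(x, y, j)` (explicit tuple, no definition): `x = g(5T+u) + r` in the
teeth (`u < 5`, `r < g`), `y = 5tg + s` on the final climb (`s ≤ tg`), and the POTENTIAL bound
`T + 4j + 3 ≤ t ∨ (u < 2 ∧ h(y) ≤ −gT + g − 1 ∧ T + 4j + 2 ≤ t)` (potential `E ∈ {T, T+1}` via the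
valley certificate `h(y) ≤ h(v_T) + g − 1`; `E + 4j ≤ t − 2`). TRANSITIONS (each under legality of
the pair; PROOF-saw §4): LEMMA X (`saw_stepX`, `x ↦ x + 1`, cases on the block `(u, r)` of `x`):
(a) `r + 1 < g` — same block, certificate kept; else `r + 1 = g` and (b) `u = 0 → 1` — ascent, certificate
kept; (c) `u = 1 → 2` — reaching the peak block: a live certificate contradicts legality of `(x, y)`
(`h(x) = −gT + 2g − 1`), so `E` was already `T + 1`; (d) `u = 2 → 3`, `u = 3 → 4` — descent, `E = T + 1`;
(e) `u = 4 → (T + 1, 0, 0)` — entering the next valley: legality of `(x + 1, y)` IS `cert_{T+1}(y)`;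
the potential never increases. LEMMA Y (`saw_stepY`, `y ↦ y − 1`): `s ≥ 1` is forced (`h(5tg) = −tg`
lies `≥ g + 1` below every legal partner, as `T ≤ t − 2`) and `h(y − 1) = h(y) − 1` keeps the
certificate. LEMMA S (non-skew split `[x, c) ∪ [c, y)`, budget `j + 1 ↦ j`): Case A `c ≥ 5tg` — the
left child is invariant by arithmetic; Case B `c < 5tg` — either `[x, c)` is not legal (its root is
good by the bridge) or (`saw_splitB`) the tooth-height bounds `−g(T+1) + 1 ≤ h ≤ −gT + 2g`
(`saw_bounds`, read off `sawH_tooth`) force `T(c) ≤ T(x) + 3`, and the right child is invariant.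
(L) `saw_two`: an invariant interval has length `> 2` (no two-leaf node). The abstract game
`des_ne_none_of_inv` (H3a) assembles them by structural induction; INITIAL `Inv(0, D, k)` holds with
`T = u = r = 0`, `s = tg`, certificate `h(D) = 0 ≤ g − 1`, and `4 * k + 2 ≤ t`. Constant: `t = 4k + 2`
(`D = (24k+12)g`); the in-seat solver thresholds t*(k) are LENS-LOCAL·UNCERTIFIED and cited nowhere;
t = 4k + 2 is what the written proof pays; any `t = O(k)` serves the rung.
MODEL (verbatim for every file): «Circuits ArithCircuit K σ read in FreeAlgebra K σ (ncEval), K a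
field, σ finite; weighted sum gates of any fan-in, product gates of fan-in 1 or 2 (general fan-in:
the landed binz of O-L6-19); the INPUT circuit of a rung is const-free with non-constant output
(print: homogenisation, HWY10 §2 / LMS16 Lemma 4.2 — not formalised; same clause as
ncPerPoly_uptPrint); the instrument (H2) is proved in the wider ZERO-CONST model (const operands
allowed iff 0) so that block substitutions with vanishing entries stay inside it.»
print-KNOWN (LMS16 Theorem 1.3 / §6; FLOS20 Theorem 20: interval lemmas for tilted masks) ·
kernel-NEW · INSTRUMENT · 0 S-currency · closes NO item · A_nc stmt-23446 / PerNotNcVP / VP ≠ VNP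
untouched.
[cite: FijalkowLagardeOhlmannSerre2020, Theorem 5, Theorem 13 (p. 12), Theorem 20, §5]
[cite: LimayeMalodSrinivasan2016, Theorem 1.3, §6 (non-skew depth)]
-/

noncomputable section

namespace Summit.ValiantsHypothesis.ValiantsHypothesis.Theorems.NcSawtoothDesignation

set_option linter.dupNamespace false
open Summit.ValiantsHypothesis.ValiantsHypothesis.Theorems.NcUniqueParseTree
  Summit.ValiantsHypothesis.ValiantsHypothesis.Theorems.NcHankelIntervalModel
  Summit.ValiantsHypothesis.ValiantsHypothesis.Theorems.NcHankelIntervalBound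
  Summit.ValiantsHypothesis.ValiantsHypothesis.Theorems.NcNonSkewDepthShapes
  Summit.ValiantsHypothesis.ValiantsHypothesis.Theorems.NcSawtoothMask

/-! ### §1 The bridge instantiated and the two-leaf exclusion -/

/-- GOODNESS BRIDGE for the sawtooth: `|h(x+m) − h(x)| ≥ g ⟹ [x, x+m)` is good (`(3tg − g)`-close to
`A` or `Aᶜ`). Contrapositive: a node that is not good sits on a LEGAL pair.
[cite: FijalkowLagardeOhlmannSerre2020, Theorem 13 (p. 12)] -/
theorem saw_good {t g x m : ℕ} (hg : 0 < g) (hy : x + m ≤ g * (6 * t))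
    (h : (g : ℤ) ≤ |sawH t g (x + m) - sawH t g x|) :
    ivGood (sawMask t g) (g * (3 * t) - g) x m = true := by
  have hc := card_sawMask t g
  refine ivGood_of_le (sawMask t g) (g := g) ?_ ?_ ?_
  · rw [hc.1]; omega
  · rw [hc.2]; omega
  · rwa [hgt_sawMask hg hy, hgt_sawMask hg (show x ≤ g * (6 * t) by omega)]

/-- An invariant interval is longer than `2`: no node of the game has two leaves.
[cite: FijalkowLagardeOhlmannSerre2020, Theorem 20] -/
theorem saw_two {t g j T u r s : ℕ} (hr : r < g) (hu : u < 5)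
    (hE : T + 4 * j + 3 ≤ t ∨
      (u < 2 ∧ sawH t g (g * (5 * t) + s) + g * T + 1 ≤ g ∧ T + 4 * j + 2 ≤ t)) :
    g * (5 * T + u) + r + 2 < g * (5 * t) + s := by
  have hT : T + 2 ≤ t := by rcases hE with h | ⟨-, -, h⟩ <;> omega
  have h1 : g * (5 * T + u + 1) + g * 5 ≤ g * (5 * t) := by
    rw [← Nat.mul_add]; exact Nat.mul_le_mul_left g (by omega)
  have h2 : g * (5 * T + u + 1) = g * (5 * T + u) + g := Nat.mul_add_one g (5 * T + u)
  omega

/-! ### §2 The three transitions -/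

/-- Tooth-height BOUNDS read off `sawH_tooth` (H3b): on tooth `T`, `−gT − r ≤ h ≤ −gT + 2g`, with the
exact values at the valley floor block (`u = 0`: `h = −gT + r`) and the first ascent block
(`u = 1`: `h = −gT + g + r`). (Named auxiliary of this file; pure case arithmetic.)
[cite: FijalkowLagardeOhlmannSerre2020, Theorem 20] -/
theorem saw_bounds {t g T u r : ℕ} (hg : 0 < g) (hT : T < t) (hu : u < 5) (hr : r < g) :
    -(r : ℤ) ≤ sawH t g (g * (5 * T + u) + r) + g * T ∧
      sawH t g (g * (5 * T + u) + r) + g * T ≤ 2 * g ∧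
      (u = 0 → sawH t g (g * (5 * T + u) + r) + g * T = r) ∧
      (u = 1 → sawH t g (g * (5 * T + u) + r) + g * T = g + r) := by
  have h := sawH_tooth hg hT hu hr
  have hr' : (r : ℤ) < g := by exact_mod_cast hr
  rcases (show u = 0 ∨ u = 1 ∨ u = 2 ∨ u = 3 ∨ u = 4 by omega) with rfl | rfl | rfl | rfl | rfl <;>
    norm_num at h ⊢ <;> omega

/-- TRANSITION X (`x ↦ x + 1`, the new pair legal): the invariant passes to the right child of a
skew node whose left child is a leaf. [cite: FijalkowLagardeOhlmannSerre2020, Theorem 20] -/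
theorem saw_stepX {t g j T u r s : ℕ} (hg : 0 < g) (hu : u < 5) (hr : r < g)
    (hE : T + 4 * j + 3 ≤ t ∨
      (u < 2 ∧ sawH t g (g * (5 * t) + s) + g * T + 1 ≤ g ∧ T + 4 * j + 2 ≤ t))
    (hl : |sawH t g (g * (5 * t) + s) - sawH t g (g * (5 * T + u) + r)| ≤ (g : ℤ) - 1)
    (hl' : |sawH t g (g * (5 * t) + s) - sawH t g (g * (5 * T + u) + r + 1)| ≤ (g : ℤ) - 1) :
    ∃ T' u' r', g * (5 * T + u) + r + 1 = g * (5 * T' + u') + r' ∧ u' < 5 ∧ r' < g ∧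
      (T' + 4 * j + 3 ≤ t ∨
        (u' < 2 ∧ sawH t g (g * (5 * t) + s) + g * T' + 1 ≤ g ∧ T' + 4 * j + 2 ≤ t)) := by
  have hT : T + 2 ≤ t := by rcases hE with h | ⟨-, -, h⟩ <;> omega
  by_cases hrg : r + 1 < g
  · exact ⟨T, u, r + 1, by omega, hu, hrg, hE⟩
  rw [abs_le] at hl hl'
  rcases (show u = 0 ∨ u = 1 ∨ u = 2 ∨ u = 3 ∨ u = 4 by omega) with rfl | rfl | rfl | rfl | rfl
  · -- leaving the valley floor block: `(T, 0, g−1) ↦ (T, 1, 0)`, certificate unchanged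
    have e0 : g * (5 * T + 0) = g * (5 * T) + g * 0 := Nat.mul_add g (5 * T) 0
    have e1 : g * (5 * T + 1) = g * (5 * T) + g * 1 := Nat.mul_add g (5 * T) 1
    refine ⟨T, 1, 0, by omega, by omega, hg, ?_⟩
    rcases hE with h | ⟨-, h2, h3⟩
    · exact Or.inl h
    · exact Or.inr ⟨by omega, h2, h3⟩
  · -- reaching the peak block: `(T, 1, g−1) ↦ (T, 2, 0)`; a certificate would contradict legality
    have e1 : g * (5 * T + 1) = g * (5 * T) + g * 1 := Nat.mul_add g (5 * T) 1
    have e2 : g * (5 * T + 2) = g * (5 * T) + g * 2 := Nat.mul_add g (5 * T) 2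
    obtain ⟨-, -, -, hx1⟩ := saw_bounds hg (show T < t by omega) hu hr
    refine ⟨T, 2, 0, by omega, by omega, hg, Or.inl ?_⟩
    rcases hE with h | ⟨-, h2, -⟩
    · exact h
    · have := hx1 rfl; omega
  · -- inside the descent: `(T, 2, g−1) ↦ (T, 3, 0)`
    have e2 : g * (5 * T + 2) = g * (5 * T) + g * 2 := Nat.mul_add g (5 * T) 2
    have e3 : g * (5 * T + 3) = g * (5 * T) + g * 3 := Nat.mul_add g (5 * T) 3
    refine ⟨T, 3, 0, by omega, by omega, hg, Or.inl ?_⟩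
    rcases hE with h | ⟨h, -, -⟩ <;> omega
  · -- inside the descent: `(T, 3, g−1) ↦ (T, 4, 0)`
    have e3 : g * (5 * T + 3) = g * (5 * T) + g * 3 := Nat.mul_add g (5 * T) 3
    have e4 : g * (5 * T + 4) = g * (5 * T) + g * 4 := Nat.mul_add g (5 * T) 4
    refine ⟨T, 4, 0, by omega, by omega, hg, Or.inl ?_⟩
    rcases hE with h | ⟨h, -, -⟩ <;> omega
  · -- entering the next valley: `(T, 4, g−1) ↦ (T+1, 0, 0)`; legality of the new pair IS the certificate
    have e4 : g * (5 * T + 4) = g * (5 * T) + g * 4 := Nat.mul_add g (5 * T) 4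
    have e5 : g * (5 * (T + 1) + 0) = g * (5 * T) + g * 5 := by ring
    have h43 : T + 4 * j + 3 ≤ t := by rcases hE with h | ⟨h, -, -⟩ <;> omega
    have ex : g * (5 * T + 4) + r + 1 = g * (5 * (T + 1) + 0) + 0 := by omega
    rw [ex] at hl'
    obtain ⟨-, -, hx0, -⟩ := saw_bounds hg (show T + 1 < t by omega) (show 0 < 5 by omega) hg
    have := hx0 rfl
    exact ⟨T + 1, 0, 0, ex, by omega, hg, Or.inr ⟨by omega, by omega, by omega⟩⟩

/-- TRANSITION Y (`y ↦ y − 1`): `y` stays on the final climb (`s ≥ 1`) and the certificate is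
monotone; the invariant passes to the left child of a skew node whose right child is a leaf.
[cite: FijalkowLagardeOhlmannSerre2020, Theorem 20] -/
theorem saw_stepY {t g j T u r s : ℕ} (hg : 0 < g) (hu : u < 5) (hr : r < g)
    (hE : T + 4 * j + 3 ≤ t ∨
      (u < 2 ∧ sawH t g (g * (5 * t) + s) + g * T + 1 ≤ g ∧ T + 4 * j + 2 ≤ t))
    (hl : |sawH t g (g * (5 * t) + s) - sawH t g (g * (5 * T + u) + r)| ≤ (g : ℤ) - 1) :
    1 ≤ s ∧ (T + 4 * j + 3 ≤ t ∨
      (u < 2 ∧ sawH t g (g * (5 * t) + (s - 1)) + g * T + 1 ≤ g ∧ T + 4 * j + 2 ≤ t)) := by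
  have hT : T + 2 ≤ t := by rcases hE with h | ⟨-, -, h⟩ <;> omega
  obtain ⟨hlo, -, -, -⟩ := saw_bounds hg (show T < t by omega) hu hr
  have hy := sawH_final (t := t) hg s
  have hgt : (g : ℤ) * T + g * 2 ≤ g * t := by
    have h := Nat.mul_le_mul_left g hT
    rw [Nat.mul_add] at h
    exact_mod_cast h
  rw [abs_le] at hl
  have hs : 1 ≤ s := by
    by_contra h0
    obtain rfl : s = 0 := by omega
    omega
  refine ⟨hs, ?_⟩
  obtain ⟨s', rfl⟩ : ∃ s', s = s' + 1 := ⟨s - 1, by omega⟩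
  rw [Nat.add_sub_cancel]
  have hy' := sawH_final (t := t) hg s'
  rcases hE with h | ⟨h1, h2, h3⟩
  · exact Or.inl h
  · exact Or.inr ⟨h1, by omega, h3⟩

/-- TRANSITION S, case B (split point `c` in the teeth, `[x, c)` legal): tooth heights force
`T(c) ≤ T(x) + 3`, so the right child `[c, y)` is invariant with budget `j` (from `j + 1`).
[cite: FijalkowLagardeOhlmannSerre2020, Theorem 20] -/
theorem saw_splitB {t g j T u r s c : ℕ} (hg : 0 < g) (hu : u < 5) (hr : r < g)
    (hE : T + 4 * (j + 1) + 3 ≤ t ∨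
      (u < 2 ∧ sawH t g (g * (5 * t) + s) + g * T + 1 ≤ g ∧ T + 4 * (j + 1) + 2 ≤ t))
    (hc : c < g * (5 * t))
    (hl : |sawH t g c - sawH t g (g * (5 * T + u) + r)| ≤ (g : ℤ) - 1) :
    ∃ T' u' r', c = g * (5 * T' + u') + r' ∧ u' < 5 ∧ r' < g ∧ T' + 4 * j + 3 ≤ t := by
  have hT : T + 4 * j + 6 ≤ t := by rcases hE with h | ⟨-, -, h⟩ <;> omega
  obtain ⟨q, r', hr', rfl⟩ : ∃ q r', r' < g ∧ c = g * q + r' :=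
    ⟨c / g, c % g, Nat.mod_lt c hg, (Nat.div_add_mod c g).symm⟩
  have hq : q < 5 * t := by
    by_contra h
    have := Nat.mul_le_mul_left g (show 5 * t ≤ q by omega)
    omega
  obtain ⟨T', u', hu', rfl⟩ : ∃ T' u', u' < 5 ∧ q = 5 * T' + u' :=
    ⟨q / 5, q % 5, Nat.mod_lt q (by omega), (Nat.div_add_mod q 5).symm⟩
  refine ⟨T', u', r', rfl, hu', hr', ?_⟩
  obtain ⟨hlo, -, -, -⟩ := saw_bounds hg (show T < t by omega) hu hr
  obtain ⟨-, hhi, -, -⟩ := saw_bounds hg (show T' < t by omega) hu' hr'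
  rw [abs_le] at hl
  by_contra h4
  have h5 := Nat.mul_le_mul_left g (show T + 4 ≤ T' by omega)
  rw [Nat.mul_add] at h5
  have h6 : (g : ℤ) * T + g * 4 ≤ g * T' := by exact_mod_cast h5
  omega

/-! ### §3 The interval lemma -/

/-- ★ **The tilted-sawtooth interval lemma.** For `g ≥ 1` and `4k + 2 ≤ t`, every shape with
`6tg` leaves and non-skew depth `≤ k`, placed at `0`, is designated for the good-interval predicate
of the sawtooth mask with slack `δ = 3tg − g`. (LMS16 Theorem 1.3 / FLOS20 Theorem 20 — the
combinatorial heart of the non-skew-depth lower bound, for this lane's own mask.)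
[cite: FijalkowLagardeOhlmannSerre2020, Theorem 20] [cite: LimayeMalodSrinivasan2016, Theorem 1.3, §6] -/
theorem saw_designated {t g k : ℕ} (hg : 1 ≤ g) (hk : 4 * k + 2 ≤ t) (S : Shape)
    (hS : S.size = g * (6 * t)) (hn : nsd S ≤ k) :
    des (ivGood (sawMask t g) (g * (3 * t) - g)) S 0 ≠ none := by
  have hg0 : 0 < g := hg
  have hD : g * (6 * t) = g * (5 * t) + g * t := by ring
  refine des_ne_none_of_inv (ivGood (sawMask t g) (g * (3 * t) - g))
    (fun x y j => ∃ T u r s, x = g * (5 * T + u) + r ∧ u < 5 ∧ r < g ∧ y = g * (5 * t) + s ∧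
      s ≤ g * t ∧ (T + 4 * j + 3 ≤ t ∨
        (u < 2 ∧ sawH t g (g * (5 * t) + s) + g * T + 1 ≤ g ∧ T + 4 * j + 2 ≤ t)))
    ?_ ?_ ?_ ?_ S ?_ 0 k hn ?_
  · -- no two-leaf node
    rintro x j ⟨T, u, r, s, hx, hu, hr, hy, -, hE⟩
    exfalso
    have := saw_two hr hu hE
    omega
  · -- skew step in `x`
    rintro x m j _ ⟨T, u, r, s, hx, hu, hr, hy, hs, hE⟩ hgood
    have hl : |sawH t g (g * (5 * t) + s) - sawH t g (g * (5 * T + u) + r)| ≤ (g : ℤ) - 1 := by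
      by_contra h
      have h' := saw_good (m := 1 + m) hg0 (show x + (1 + m) ≤ g * (6 * t) by omega)
        (by rw [hy, hx]; rw [not_le] at h; omega)
      simp only [hgood, Bool.false_eq_true] at h'
    by_cases hl2 : |sawH t g (g * (5 * t) + s) - sawH t g (g * (5 * T + u) + r + 1)| ≤ (g : ℤ) - 1
    · obtain ⟨T', u', r', he, hu', hr', hE'⟩ := saw_stepX hg0 hu hr hE hl hl2
      exact Or.inr ⟨T', u', r', s, by omega, hu', hr', by omega, hs, hE'⟩
    · refine Or.inl (saw_good hg0 (show x + 1 + m ≤ g * (6 * t) by omega) ?_)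
      rw [show x + 1 + m = g * (5 * t) + s by omega, show x + 1 = g * (5 * T + u) + r + 1 by omega]
      rw [not_le] at hl2
      omega
  · -- skew step in `y`
    rintro x m j _ ⟨T, u, r, s, hx, hu, hr, hy, hs, hE⟩ hgood
    have hl : |sawH t g (g * (5 * t) + s) - sawH t g (g * (5 * T + u) + r)| ≤ (g : ℤ) - 1 := by
      by_contra h
      have h' := saw_good (m := m + 1) hg0 (show x + (m + 1) ≤ g * (6 * t) by omega)
        (by rw [hy, hx]; rw [not_le] at h; omega)
      simp only [hgood, Bool.false_eq_true] at h'
    obtain ⟨hs1, hE'⟩ := saw_stepY hg0 hu hr hE hl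
    exact Or.inr ⟨T, u, r, s - 1, hx, hu, hr, by omega, by omega, hE'⟩
  · -- non-skew split at `c = x + m₁`
    rintro x m₁ m₂ j _ _ ⟨T, u, r, s, hx, hu, hr, hy, hs, hE⟩ hgood
    by_cases hcA : g * (5 * t) ≤ x + m₁
    · refine Or.inl (Or.inr ⟨T, u, r, x + m₁ - g * (5 * t), hx, hu, hr, by omega, by omega,
        Or.inl ?_⟩)
      rcases hE with h | ⟨-, -, h⟩ <;> omega
    · by_cases hlB : |sawH t g (x + m₁) - sawH t g (g * (5 * T + u) + r)| ≤ (g : ℤ) - 1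
      · obtain ⟨T', u', r', he, hu', hr', h3⟩ :=
          saw_splitB hg0 hu hr hE (show x + m₁ < g * (5 * t) by omega) hlB
        exact Or.inr (Or.inr ⟨T', u', r', s, he, hu', hr', by omega, hs, Or.inl h3⟩)
      · refine Or.inl (Or.inl (saw_good hg0 (show x + m₁ ≤ g * (6 * t) by omega) ?_))
        rw [← hx] at hlB
        rw [not_le] at hlB
        omega
  · -- the root interval has at least two positions
    have : 1 * 2 ≤ g * t := Nat.mul_le_mul hg (by omega)
    omega
  · -- INITIAL: `Inv(0, D, k)` with `T = u = r = 0`, `s = tg`, certificate `h(D) = 0 ≤ g − 1`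
    refine ⟨0, 0, 0, g * t, by simp, by omega, hg0, by rw [Nat.zero_add, hS, hD], le_rfl,
      Or.inr ⟨by omega, ?_, by omega⟩⟩
    rw [sawH_final (t := t) hg0 (g * t)]
    push_cast
    omega

end Summit.ValiantsHypothesis.ValiantsHypothesis.Theorems.NcSawtoothDesignation
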